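import Literature.AlgebraicGeometry.Motives.RationalPointsOnLinearSubspace
import Literature.AlgebraicGeometry.Motives.ProjectiveSpaceHyperplaneMultiplicity
import Literature.AlgebraicGeometry.Motives.CompleteIntersectionLinesThroughPoints
import Literature.AlgebraicGeometry.Motives.ChowZeroSupportedOnHyperplaneSection
import Literature.AlgebraicGeometry.Motives.OpenImmersionGraph
import HarnessLib

/-!
# A line in `ℙ⁸` over a field with two marked rational points (the generic fibre of Hirschowitz–Iyer's ruled surface)

Bookkeeping, over an arbitrary infinite field `L` (the function field `F'` of the parameter curve
of Hirschowitz–Iyer 2010, Lemma 2.2, `s = 0`), for the GENERIC FIBRE of the ruled surface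
`H'_Z → Z` of that proof: the line `ℙ(span(u, v)) ⊆ ℙ⁸_L` through the rational point `[p]`,
`p = αu + βv`, its generic point `γ`, the marked point `σ = [p]` (the generic point of the curve `W`
in the application) and the point `τ` cut out by a hyperplane `V₊(m)` with `m(p) ≠ 0` (the
hyperplane section), and the rational function `g` on the line with `[σ] - [τ] = [div g]` (HI:
"this linear system has degree `d` along the fibers of this bundle. Thus we have
`H'_Z · (Z × Y) = d H_Z + ψ⁻¹(D)`" — on the generic fibre `ℙ¹_{F'}` two rational points are
linearly equivalent). Everything comes from the tree: `LinesInProjectiveSpace` (generic points of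
linear subspaces), `ProjectiveSpaceHyperplaneMultiplicity` (`V₊(m) · [line] = [point]`),
`RationalPointsOnLinearSubspace` (`[σ] - [τ] = [div g]` on a line).

* `LinePencilData L` — the data `(u, v, p = αu + βv ≠ 0, m)`; `Λ`, `γ`, `σ`, `τ`, `lineSub`
  (`= closure {γ}` as a closed subvariety), with `toIdeal_γ`, `mem_γ_of_forall_eval_eq_zero`,
  `height_γ`, `γ_specializes_σ`, `σ_eq_pt`, `primeInter_γ : V₊(m) · [closure γ] = [τ]`,
  `γ_specializes_τ`, `σ_ne_τ`, `residueDegree_σ`, `residueDegree_τ`;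
* `exists_ord_eq` — `g ∈ K(closure γ)ˣ` with `[σ] - [τ] = [div g]` on the line.

## References

* A. Hirschowitz, J. N. N. Iyer, Contemp. Math. 522 (2010), arXiv:0903.5018, §2 Lemma 2.2 (proof).
  [HirschowitzIyer2010]
* W. Fulton, *Intersection Theory* (1998), §1.3, Example 2.5.1. [Fulton1998]
* R. Hartshorne, *Algebraic Geometry* (1977), I Ex. 2.11, II Ex. 2.7. [Hartshorne1977]
-/

noncomputable section

open CategoryTheory AlgebraicGeometry Order MvPolynomial Topology TopologicalSpace
open Literature.AlgebraicGeometry.Motives.Segre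

universe u

namespace Literature.AlgebraicGeometry.Motives

attribute [local instance] MvPolynomial.gradedAlgebra

/-- The data of a line `ℙ(span(u, v)) ⊆ ℙ⁸_L` with a marked vector `p = αu + βv ≠ 0` and a linear
form `m` with `m(p) ≠ 0`. [folklore] -/
structure LinePencilData (L : Type u) [Field L] where
  /-- first spanning vector -/
  u : Fin (8 + 1) → L
  /-- second spanning vector -/
  v : Fin (8 + 1) → L
  /-- the marked vector -/
  p : Fin (8 + 1) → L
  /-- coefficients of `p` -/
  α : L
  /-- coefficients of `p` -/
  β : L
  hli : LinearIndependent L ![u, v]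
  hp : p = α • u + β • v
  hp0 : p ≠ 0
  /-- the linear form of the hyperplane section -/
  m : MvPolynomial (Fin (8 + 1)) L
  hm : m.IsHomogeneous 1
  hmp : MvPolynomial.eval p m ≠ 0

namespace LinePencilData

variable {L : Type u} [Field L] (D : LinePencilData L)

local notation "𝓐L" => MvPolynomial.homogeneousSubmodule (Fin (8 + 1)) L

/-- `p` lies on the plane `span(u, v)`. [folklore] -/
theorem p_mem_span : D.p ∈ Submodule.span L (Set.range ![D.u, D.v]) := by
  rw [D.hp, Matrix.range_cons_cons_empty, Submodule.mem_span_pair]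
  exact ⟨D.α, D.β, rfl⟩

/-- **The marked rational point `σ = [p]`.** [cite: Hartshorne1977, II Ex. 2.7] -/
def σ : ↥(projectiveSpace 8 L).left := (ProjectiveSpace.pointOfVec L D.p D.hp0).pt

/-- Bookkeeping. [folklore] -/
theorem σ_eq_pt : D.σ = (ProjectiveSpace.pointOfVec L D.p D.hp0).pt := rfl

/-- A rational point has residue degree `1` over the base. [folklore] -/
theorem _root_.Literature.AlgebraicGeometry.Motives.AlgPoints.residueDegree_pt {k : Type u} [Field k]
    {X : SchemeOver k} (t : AlgPoints X k) : X.hom.residueDegree t.pt = 1 := by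
  have hw : t.left ≫ X.hom = 𝟙 _ := by
    rw [Over.w t]
    change Spec.map (CommRingCat.ofHom (algebraMap k k)) = 𝟙 _
    rw [Algebra.algebraMap_self, CommRingCat.ofHom_id, Spec.map_id]
  have h := residueDegree_comp t.left X.hom (IsLocalRing.closedPoint k)
  rw [hw] at h
  erw [Scheme.Hom.residueDegree_id] at h
  exact Nat.eq_one_of_mul_eq_one_left h.symm

/-- Bookkeeping. [folklore] -/
theorem height_σ : height D.σ = 0 := OpenGraph.height_pt _

/-- Bookkeeping. [folklore] -/
theorem residueDegree_σ : (projectiveSpace 8 L).hom.residueDegree D.σ = 1 := AlgPoints.residueDegree_pt _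

/-- `m ∉ 𝔭_σ` (`m(p) ≠ 0`). [folklore] -/
theorem m_notMem_σ : D.m ∉ ProjectiveSpectrum.asHomogeneousIdeal (𝒜 := 𝓐L) D.σ := by
  intro h
  have hmem : D.σ ∈ ProjectiveSpectrum.zeroLocus 𝓐L {D.m} :=
    (ProjectiveSpectrum.mem_zeroLocus _ _ _).mpr (Set.singleton_subset_iff.mpr h)
  have h' := (ProjectiveSpace.pt_pointOfVec_mem_zeroLocus_iff D.p D.hp0 one_pos
    ((mem_homogeneousSubmodule _ _).mpr D.hm)).mp hmem
  rw [MvPolynomial.aeval_eq_eval] at h'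
  exact D.hmp h'

/-- Bookkeeping. [folklore] -/
theorem m_mem_grading : D.m ∈ grading (Fin (8 + 1)) L 1 := (mem_homogeneousSubmodule _ _).mpr D.hm

/-- Bookkeeping. [folklore] -/
theorem m_ne_zero : D.m ≠ 0 := fun h => D.hmp (by rw [h, map_zero])

/-- **The hyperplane `V₊(m)`** as a Cartier divisor on `ℙ⁸_L`. [folklore] -/
def H : CartierDivisor (projectiveSpace 8 L).left := ProjSpace.formDivisor D.m D.m_mem_grading D.m_ne_zero

variable [Infinite L]

/-- **Seven independent linear forms cutting out `span(u, v)`**, containing in their span every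
polynomial vanishing on `span(u, v)`. [cite: Hartshorne1977, I Ex. 2.11] -/
theorem exists_forms : ∃ Λ : Fin (8 - 1) → MvPolynomial (Fin (8 + 1)) L, LinearIndependent L Λ ∧
    (∀ j, (Λ j).IsHomogeneous 1) ∧
    (∀ G : MvPolynomial (Fin (8 + 1)) L, (∀ q ∈ Submodule.span L (Set.range ![D.u, D.v]),
      MvPolynomial.eval q G = 0) → G ∈ Ideal.span (Set.range Λ)) ∧
    ∀ j, ∀ q ∈ Submodule.span L (Set.range ![D.u, D.v]), MvPolynomial.eval q (Λ j) = 0 := by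
  obtain ⟨t, Λ, ht, hli, hhom, hmem, hvan⟩ :=
    EsnaultLevineViehweg.exists_linearForms_forall_mem_ideal_span
      (fun G : {G : MvPolynomial (Fin (8 + 1)) L // ∀ q ∈ Submodule.span L (Set.range ![D.u, D.v]),
        MvPolynomial.eval q G = 0} => (G : MvPolynomial (Fin (8 + 1)) L)) D.hli (fun G => G.2)
  obtain rfl : t = 8 - 1 := by omega
  exact ⟨Λ, hli, hhom, fun G hG => hmem ⟨G, hG⟩, hvan⟩

/-- The seven linear forms. [folklore] -/
def Λ : Fin (8 - 1) → MvPolynomial (Fin (8 + 1)) L := D.exists_forms.choose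

/-- Bookkeeping. [folklore] -/
theorem Λ_linearIndependent : LinearIndependent L D.Λ := D.exists_forms.choose_spec.1

/-- Bookkeeping. [folklore] -/
theorem Λ_isHomogeneous (j : Fin (8 - 1)) : (D.Λ j).IsHomogeneous 1 := D.exists_forms.choose_spec.2.1 j

/-- Bookkeeping. [folklore] -/
theorem mem_span_Λ {G : MvPolynomial (Fin (8 + 1)) L}
    (hG : ∀ q ∈ Submodule.span L (Set.range ![D.u, D.v]), MvPolynomial.eval q G = 0) :
    G ∈ Ideal.span (Set.range D.Λ) :=
  D.exists_forms.choose_spec.2.2.1 G hG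

/-- Bookkeeping. [folklore] -/
theorem eval_Λ (j : Fin (8 - 1)) {q : Fin (8 + 1) → L} (hq : q ∈ Submodule.span L (Set.range ![D.u, D.v])) :
    MvPolynomial.eval q (D.Λ j) = 0 :=
  D.exists_forms.choose_spec.2.2.2 j q hq

/-- **The generic point `γ` of the line `V₊(Λ) = ℙ(span(u, v))`.** [cite: Hartshorne1977, I Ex. 2.11] -/
def γ : ↥(projectiveSpace 8 L).left :=
  linearSubspacePoint D.Λ D.Λ_linearIndependent D.Λ_isHomogeneous (by norm_num)

/-- The homogeneous prime of `γ` is `(Λ)`. [cite: Hartshorne1977, I Ex. 2.11] -/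
theorem toIdeal_γ :
    (ProjectiveSpectrum.asHomogeneousIdeal (𝒜 := 𝓐L) D.γ).toIdeal = Ideal.span (Set.range D.Λ) :=
  toIdeal_linearSubspacePoint _ _ _ _

/-- A polynomial vanishing on `span(u, v)` lies in `𝔭_γ`. [folklore] -/
theorem mem_γ_of_forall_eval_eq_zero {G : MvPolynomial (Fin (8 + 1)) L}
    (hG : ∀ q ∈ Submodule.span L (Set.range ![D.u, D.v]), MvPolynomial.eval q G = 0) :
    G ∈ ProjectiveSpectrum.asHomogeneousIdeal (𝒜 := 𝓐L) D.γ := by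
  have h := D.mem_span_Λ hG
  rw [← D.toIdeal_γ] at h
  exact h

/-- `dim closure {γ} = 1`. [cite: Hartshorne1977, I Ex. 2.11] -/
theorem height_γ : height D.γ = 1 := by
  have h := height_linearSubspacePoint D.Λ D.Λ_linearIndependent D.Λ_isHomogeneous (by norm_num)
  exact h

/-- `closure {γ} = V₊(Λ)`. [cite: Hartshorne1977, I Ex. 2.11] -/
theorem closure_γ : closure {D.γ} = ProjectiveSpectrum.zeroLocus 𝓐L (Set.range D.Λ) :=
  closure_linearSubspacePoint _ _ _ _

/-- `γ` is a line point of `ℙ⁸_L`. [folklore] -/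
theorem isLinearSubspacePoint_γ : IsLinearSubspacePoint 1 8 (𝟙 (projectiveSpace 8 L)) D.γ := by
  refine ⟨D.height_γ, D.Λ, D.Λ_linearIndependent, D.Λ_isHomogeneous, ?_⟩
  change (fun x => x) '' closure {D.γ} = _
  rw [Set.image_id', D.closure_γ]

/-- `σ` lies on the line. [folklore] -/
theorem σ_mem_zeroLocus : D.σ ∈ ProjectiveSpectrum.zeroLocus 𝓐L (Set.range D.Λ) := by
  refine (ProjectiveSpectrum.mem_zeroLocus _ _ _).mpr ?_
  rintro _ ⟨j, rfl⟩
  have hj : D.σ ∈ ProjectiveSpectrum.zeroLocus 𝓐L {D.Λ j} := by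
    refine (ProjectiveSpace.pt_pointOfVec_mem_zeroLocus_iff D.p D.hp0 one_pos
      ((mem_homogeneousSubmodule _ _).mpr (D.Λ_isHomogeneous j))).mpr ?_
    rw [MvPolynomial.aeval_eq_eval]
    exact D.eval_Λ j D.p_mem_span
  exact Set.singleton_subset_iff.mp ((ProjectiveSpectrum.mem_zeroLocus _ _ _).mp hj)

/-- `γ ⤳ σ`. [folklore] -/
theorem γ_specializes_σ : D.γ ⤳ D.σ := by
  rw [specializes_iff_mem_closure, D.closure_γ]
  exact D.σ_mem_zeroLocus

/-- `m ∉ 𝔭_γ`. [folklore] -/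
theorem m_notMem_γ : D.m ∉ ProjectiveSpectrum.asHomogeneousIdeal (𝒜 := 𝓐L) D.γ := fun h => by
  have hle : @LE.le (ProjectiveSpectrum 𝓐L) _ D.γ D.σ :=
    (ProjectiveSpectrum.le_iff_mem_closure 𝓐L (D.γ : ProjectiveSpectrum 𝓐L) D.σ).mpr D.γ_specializes_σ.mem_closure
  have hle' : ProjectiveSpectrum.asHomogeneousIdeal (𝒜 := 𝓐L) D.γ ≤
      ProjectiveSpectrum.asHomogeneousIdeal (𝒜 := 𝓐L) D.σ := hle
  exact D.m_notMem_σ (hle' h)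

/-- **The hyperplane section of the line is a rational point, with multiplicity one.**
[cite: Fulton1998, Example 2.5.1] -/
theorem exists_τ : ∃ τ : ↥(projectiveSpace 8 L).left,
    IsLinearSubspacePoint 0 8 (𝟙 (projectiveSpace 8 L)) τ ∧ D.H.primeInter (X := projectiveSpace 8 L) D.γ = primeCycle τ := by
  have h := ProjSpace.exists_primeInter_formDivisor_eq_primeCycle_of_isLinearSubspacePoint (le_refl 1)
    D.isLinearSubspacePoint_γ D.m_mem_grading D.m_ne_zero D.m_notMem_γ
  exact h

/-- **The second marked point `τ = closure {γ} ∩ V₊(m)`.** [folklore] -/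
def τ : ↥(projectiveSpace 8 L).left := D.exists_τ.choose

/-- Bookkeeping. [folklore] -/
theorem isLinearSubspacePoint_τ : IsLinearSubspacePoint 0 8 (𝟙 (projectiveSpace 8 L)) D.τ :=
  D.exists_τ.choose_spec.1

/-- `V₊(m) · [closure γ] = [τ]`. [cite: Fulton1998, Example 2.5.1] -/
theorem primeInter_γ : D.H.primeInter (X := projectiveSpace 8 L) D.γ = primeCycle D.τ :=
  D.exists_τ.choose_spec.2

/-- Bookkeeping. [folklore] -/
theorem height_τ : height D.τ = 0 := D.isLinearSubspacePoint_τ.1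

/-- `γ ⤳ τ`. [folklore] -/
theorem γ_specializes_τ : D.γ ⤳ D.τ := by
  refine D.H.specializes_of_primeInter_ne_zero (X := projectiveSpace 8 L) (z := D.γ) (x := D.τ) ?_
  rw [D.primeInter_γ, primeCycle_apply_self]
  exact one_ne_zero

/-- `m ∈ 𝔭_τ`. [folklore] -/
theorem m_mem_τ : D.m ∈ ProjectiveSpectrum.asHomogeneousIdeal (𝒜 := 𝓐L) D.τ := by
  by_contra h
  have hne : D.H.primeInter (X := projectiveSpace 8 L) D.γ D.τ ≠ 0 := by
    rw [D.primeInter_γ, primeCycle_apply_self]; exact one_ne_zero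
  exact D.H.not_avoids_of_primeInter_ne_zero (X := projectiveSpace 8 L) hne
    ((ProjSpace.formDivisor_avoids_iff D.m_mem_grading D.m_ne_zero zero_lt_one).2 h)

/-- `σ ≠ τ`. [folklore] -/
theorem σ_ne_τ : D.σ ≠ D.τ := fun h => D.m_notMem_σ (h ▸ D.m_mem_τ)

/-! ### `τ` is a rational point -/

omit [Infinite L] in
/-- A linear form is the sum of its degree-one terms: `f(q) = Σ_i coeff_{x_i}(f) q_i`. [folklore] -/
theorem eval_eq_sum_coeff_single_mul {f : MvPolynomial (Fin (8 + 1)) L} (hf : f.IsHomogeneous 1)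
    (q : Fin (8 + 1) → L) : MvPolynomial.eval q f = ∑ i, coeff (Finsupp.single i 1) f * q i := by
  classical
  have hdec : ∀ d : Fin (8 + 1) →₀ ℕ, d.degree = 1 → ∃ i, d = Finsupp.single i 1 := by
    intro d hd
    have hc : Multiset.card (Finsupp.toMultiset d) = 1 := by
      have h' : Multiset.card (Finsupp.toMultiset d) = d.degree := by
        rw [Finsupp.card_toMultiset, Finsupp.degree_apply]; rfl
      rw [h', hd]
    obtain ⟨i, hi⟩ := Multiset.card_eq_one.1 hc
    refine ⟨i, ?_⟩
    calc d = (Finsupp.toMultiset d).toFinsupp := by simp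
      _ = Finsupp.single i 1 := by rw [hi, Multiset.toFinsupp_singleton]
  have hf' : f = ∑ i : Fin (8 + 1), coeff (Finsupp.single i 1) f • (X i : MvPolynomial (Fin (8 + 1)) L) := by
    ext d
    rw [coeff_sum]
    simp only [coeff_smul, coeff_X, smul_eq_mul, mul_ite, mul_one, mul_zero]
    by_cases hd : d.degree = 1
    · obtain ⟨i, rfl⟩ := hdec d hd
      rw [Finset.sum_eq_single i]
      · simp
      · intro j _ hji
        rw [if_neg]
        intro h
        exact hji (Finsupp.single_left_injective one_ne_zero h)
      · intro h; exact absurd (Finset.mem_univ i) h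
    · rw [hf.coeff_eq_zero hd, Finset.sum_eq_zero]
      intro i _
      rw [if_neg]
      intro h
      apply hd
      rw [← h, Finsupp.degree_single]
  conv_lhs => rw [hf']
  simp [map_sum, smul_eval, eval_X]

omit [Infinite L] in
/-- **A `0`-plane point of `ℙ⁸_L` is a rational point**: the zero locus of `8` independent linear
forms is `[z]` for a non-zero common zero `z ∈ L⁹` (rank–nullity). [cite: Hartshorne1977, I Ex. 2.11] -/
theorem exists_eq_pt_of_isLinearSubspacePoint_zero {x : ↥(projectiveSpace 8 L).left}
    (h : IsLinearSubspacePoint 0 8 (𝟙 (projectiveSpace 8 L)) x) :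
    ∃ (z : Fin (8 + 1) → L) (hz : z ≠ 0), x = (ProjectiveSpace.pointOfVec L z hz).pt := by
  classical
  obtain ⟨h0, L', hli, hhom, hcl⟩ := h
  -- the common kernel of the `8` linear forms on `L⁹` is non-trivial
  let Φ : (Fin (8 + 1) → L) →ₗ[L] (Fin (8 - 0) → L) :=
    { toFun := fun q j => ∑ i, coeff (Finsupp.single i 1) (L' j) * q i
      map_add' := fun q q' => by
        funext j; simp only [Pi.add_apply, mul_add, Finset.sum_add_distrib]
      map_smul' := fun c q => by
        funext j; simp only [Pi.smul_apply, smul_eq_mul, RingHom.id_apply, Finset.mul_sum]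
        refine Finset.sum_congr rfl fun i _ => by ring }
  have hker : LinearMap.ker Φ ≠ ⊥ := by
    apply LinearMap.ker_ne_bot_of_finrank_lt
    simp [Module.finrank_fintype_fun_eq_card]
  obtain ⟨z, hzker, hz⟩ := Submodule.exists_mem_ne_zero_of_ne_bot hker
  refine ⟨z, hz, ?_⟩
  have hzL : ∀ j, MvPolynomial.eval z (L' j) = 0 := by
    intro j
    have hj := congrFun (LinearMap.mem_ker.mp hzker) j
    rw [eval_eq_sum_coeff_single_mul (hhom j)]
    exact hj
  have hmem : (ProjectiveSpace.pointOfVec L z hz).pt ∈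
      ProjectiveSpectrum.zeroLocus (MvPolynomial.homogeneousSubmodule (Fin (8 + 1)) L) (Set.range L') := by
    refine (ProjectiveSpectrum.mem_zeroLocus _ _ _).mpr ?_
    rintro _ ⟨j, rfl⟩
    have hj : (ProjectiveSpace.pointOfVec L z hz).pt ∈
        ProjectiveSpectrum.zeroLocus (MvPolynomial.homogeneousSubmodule (Fin (8 + 1)) L) {L' j} := by
      refine (ProjectiveSpace.pt_pointOfVec_mem_zeroLocus_iff z hz one_pos
        ((mem_homogeneousSubmodule _ _).mpr (hhom j))).mpr ?_
      rw [MvPolynomial.aeval_eq_eval]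
      exact hzL j
    exact Set.singleton_subset_iff.mp ((ProjectiveSpectrum.mem_zeroLocus _ _ _).mp hj)
  have hcl' : closure ({x} : Set ↥(projectiveSpace 8 L).left) =
      ProjectiveSpectrum.zeroLocus (MvPolynomial.homogeneousSubmodule (Fin (8 + 1)) L) (Set.range L') := by
    rw [← hcl]
    change _ = (fun y => y) '' closure {x}
    rw [Set.image_id']
  have hmem' : (ProjectiveSpace.pointOfVec L z hz).pt ∈ ({x} : Set ↥(projectiveSpace 8 L).left) := by
    rw [← closure_singleton_eq_of_height_eq_zero h0, hcl']
    exact hmem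
  exact (Set.mem_singleton_iff.mp hmem').symm

/-- Bookkeeping. [folklore] -/
theorem residueDegree_τ : (projectiveSpace 8 L).hom.residueDegree D.τ = 1 := by
  obtain ⟨z, hz, h⟩ := exists_eq_pt_of_isLinearSubspacePoint_zero D.isLinearSubspacePoint_τ
  rw [h]
  exact AlgPoints.residueDegree_pt _

/-! ### The line as a closed subvariety and the rational function `g` -/

/-- **The line `closure {γ}` as a closed subvariety of `ℙ⁸_L`** (reduced induced structure).
[folklore] -/
def lineSub : ClosedSubvariety (projectiveSpace 8 L).left :=
  ClosedSubvariety.ofPoint (projectiveSpace 8 L).left D.γ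

/-- The marked point `σ` as a point of the line. [folklore] -/
def σ' : D.lineSub.carrier := ClosedSubvariety.ofPointPt D.γ D.γ_specializes_σ

/-- The marked point `τ` as a point of the line. [folklore] -/
def τ' : D.lineSub.carrier := ClosedSubvariety.ofPointPt D.γ D.γ_specializes_τ

/-- Bookkeeping. [folklore] -/
@[simp] theorem ι_σ' : D.lineSub.ι D.σ' = D.σ := rfl

/-- Bookkeeping. [folklore] -/
@[simp] theorem ι_τ' : D.lineSub.ι D.τ' = D.τ := rfl

/-- Bookkeeping. [folklore] -/
theorem range_lineSub_ι :
    Set.range D.lineSub.ι = ProjectiveSpectrum.zeroLocus 𝓐L (Set.range D.Λ) := by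
  rw [lineSub, ClosedSubvariety.range_ofPoint_ι, D.closure_γ]

/-- Bookkeeping. [folklore] -/
theorem height_σ' : height D.σ' = 0 := by
  rw [← height_base_eq_of_isClosedImmersion' D.lineSub.ι D.σ']
  exact D.height_σ

/-- Bookkeeping. [folklore] -/
theorem height_τ' : height D.τ' = 0 := by
  rw [← height_base_eq_of_isClosedImmersion' D.lineSub.ι D.τ']
  exact D.height_τ

/-- Bookkeeping. [folklore] -/
theorem σ'_ne_τ' : D.σ' ≠ D.τ' := fun h => D.σ_ne_τ (by rw [← D.ι_σ', ← D.ι_τ', h])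

omit [Infinite L] in
/-- `ℙⁿ_L` is locally Noetherian (as proved inline by `haveI` in `CurveNet`, `SurfaceNet`,
`HirschowitzIyerQuadricCubicGysin`). [folklore] -/
instance _root_.Literature.AlgebraicGeometry.Motives.isLocallyNoetherian_projectiveSpace_left (n : ℕ) :
    IsLocallyNoetherian (projectiveSpace n L).left :=
  LocallyOfFiniteType.isLocallyNoetherian (projectiveSpace n L).hom

/-- The line is locally Noetherian. [folklore] -/
instance isLocallyNoetherian_lineSub : IsLocallyNoetherian D.lineSub.carrier :=
  LocallyOfFiniteType.isLocallyNoetherian D.lineSub.ι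

/-- **`[σ] - [τ] = [div g]` on the line** for a rational function `g ≠ 0` on it (two rational points
of `ℙ¹` are linearly equivalent). [cite: Fulton1998, §1.3 and Thm. 1.4] -/
theorem exists_ord_eq : ∃ g : D.lineSub.carrier.functionField, g ≠ 0 ∧
    ∀ y, (primeCycle D.σ' - primeCycle D.τ') y = Scheme.ord g y :=
  ProjectiveSpaceCells.exists_eq_ord_sub_primeCycle_of_range_eq_line (k := L) (N := 8) (by norm_num)
    D.Λ D.Λ_linearIndependent D.Λ_isHomogeneous D.lineSub.ι D.range_lineSub_ι D.height_σ' D.height_τ'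
    (by
      show (projectiveSpace 8 L).hom.residueDegree D.σ = (projectiveSpace 8 L).hom.residueDegree D.τ
      rw [D.residueDegree_σ, D.residueDegree_τ])

end LinePencilData

end Literature.AlgebraicGeometry.Motives

end
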